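import Mathlib
import Literature.Analysis.UnboundedOperators.ConjugateOperatorRegularity
import HarnessLib
import Summits.AtomisticToContinuum.FouriersLaw.Theorems.EmbeddedDrudeMourreMourreDissolutionLAPDissipativeResolventIdentities

/-!
# Stub `stub_mourreThresholdLAP` — F1c: Mourre's dissipative resolvent family, `ε`-derivative and adjoint

Item `stmt-AtomisticToContinuum-12594` (crux `MourreDissolution` of route `EmbeddedDrudeMourre`,
sub-problem `FouriersLaw`), line `separable-vertex-faddeev-pair-sector`, stub S6
`stub_mourreThresholdLAP` (Mourre's limiting absorption principle, `C²` form), helper F1 of the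
proof map (Mourre 1981; ABG = Amrein–Boutet de Monvel–Georgescu 1996, Lemmas 7.3.3–7.3.4, here for
unbounded `H` through its bounded resolvent), part 3/3, over
`…LAPDissipativeResolventIdentities` (notation `R(z)`, `K`, `K̃`, `G = R(z) Kinv = K̃⁻¹ R(z)`,
dissipative `M`, `ε · Im z ≤ 0` as there).

* §1 `ε ↦ G_ε(z)` is norm-differentiable on the half-line `{ε · Im z ≤ 0}` (one-sided at `0`,
  two-sided inside) with `d/dε G_ε(z) = -i G_ε(z) M G_ε(z)` (headline
  `hasDerivAt_mourreG_dissipative`); for `Im z < 0` the half-line is `[0, ∞)`; vector and scalar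
  forms `d/dε G_ε g = -i G_ε M G_ε g`, `d/dε ⟪f, G_ε g⟫ = -i ⟪f, G_ε M G_ε g⟫`;
* §2 adjoints: `(G_ε(z)[M])† = G_{-ε}(z̄)[M†]` — the mirrored parameters are again admissible and
  `M†` is dissipative (`re_inner_adjoint_nonneg`), so all estimates apply to `G†`; for self-adjoint
  `M`, `G† = G_{-ε}(z̄)` and `(H - z̄ - iεM) G† = 1`.
-/

noncomputable section

open MeasureTheory Complex Filter Topology Set
open scoped InnerProductSpace ComplexConjugate ENNReal NNReal

namespace Summit.AtomisticToContinuum.FouriersLaw.Theorems.MourreDissolution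

open Literature.Analysis.UnboundedOperators
open Literature.Analysis.UnboundedOperators.UnitaryRep

variable {H : Type*} [NormedAddCommGroup H] [InnerProductSpace ℂ H] [CompleteSpace H]

/-! ## §1. The `ε`-derivative `d/dε G_ε(z) = -i G_ε(z) M G_ε(z)` -/

/-- **`ε ↦ G_ε(z)` is norm-differentiable on the half-line `{ε · Im z ≤ 0}` with
`d/dε G_ε(z) = -i G_ε(z) M G_ε(z)`** (one-sided at `ε = 0`): from the second resolvent identity in
`ε` and the norm-continuity it implies. [cite: AmreinBoutetdeMonvelGeorgescu1996, Lemma 7.3.4] -/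
theorem hasDerivWithinAt_mourreG {M : H →L[ℂ] H} (hM : ∀ f : H, 0 ≤ (⟪f, M f⟫_ℂ).re) {z : ℂ}
    (hz : z.im ≠ 0) {ε₀ : ℝ} (hε₀ : ε₀ * z.im ≤ 0) (U : OneParameterUnitaryGroup H) :
    HasDerivWithinAt (fun ε : ℝ => mourreG U M ε z)
      (-(I : ℂ) • (mourreG U M ε₀ z * M * mourreG U M ε₀ z)) {ε : ℝ | ε * z.im ≤ 0} ε₀ := by
  have hS : ∀ᶠ ε in 𝓝[{ε : ℝ | ε * z.im ≤ 0}] ε₀, ε * z.im ≤ 0 := eventually_mem_nhdsWithin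
  -- norm continuity within the half-line
  have hcont : Tendsto (fun ε : ℝ => mourreG U M ε z) (𝓝[{ε : ℝ | ε * z.im ≤ 0}] ε₀)
      (𝓝 (mourreG U M ε₀ z)) := by
    rw [tendsto_iff_norm_sub_tendsto_zero]
    have hb : ∀ᶠ ε in 𝓝[{ε : ℝ | ε * z.im ≤ 0}] ε₀, ‖mourreG U M ε z - mourreG U M ε₀ z‖ ≤
        |ε - ε₀| * (‖M‖ * (|z.im|⁻¹ * |z.im|⁻¹)) := by
      filter_upwards [hS] with ε hε
      rw [← mul_assoc]
      exact norm_mourreG_sub_mourreG_of_eps_le hM hz hε hε₀ U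
    have h0 : Tendsto (fun ε : ℝ => |ε - ε₀| * (‖M‖ * (|z.im|⁻¹ * |z.im|⁻¹)))
        (𝓝[{ε : ℝ | ε * z.im ≤ 0}] ε₀) (𝓝 0) := by
      have h1 : Tendsto (fun ε : ℝ => |ε - ε₀|) (𝓝 ε₀) (𝓝 0) := by
        have hc : Continuous fun ε : ℝ => |ε - ε₀| := by fun_prop
        simpa using hc.tendsto ε₀
      simpa using (h1.mono_left nhdsWithin_le_nhds).mul_const (‖M‖ * (|z.im|⁻¹ * |z.im|⁻¹))
    exact squeeze_zero' (Eventually.of_forall fun _ => norm_nonneg _) hb h0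
  rw [hasDerivWithinAt_iff_isLittleO]
  have heq : (fun ε : ℝ => ((ε - ε₀ : ℝ) : ℂ) •
      (-(I : ℂ) • ((mourreG U M ε z - mourreG U M ε₀ z) * M * mourreG U M ε₀ z))) =ᶠ[𝓝[{ε : ℝ | ε * z.im ≤ 0}] ε₀]
      fun ε => mourreG U M ε z - mourreG U M ε₀ z -
        (ε - ε₀) • (-(I : ℂ) • (mourreG U M ε₀ z * M * mourreG U M ε₀ z)) := by
    filter_upwards [hS] with ε hε
    conv_rhs => rw [mourreG_sub_mourreG_of_eps hM hz hε hε₀ U, ← Complex.coe_smul]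
    rw [smul_smul, smul_smul, show ((ε - ε₀ : ℝ) : ℂ) * -(I : ℂ) = -((I : ℂ) * ((ε - ε₀ : ℝ) : ℂ)) by ring,
      sub_mul, sub_mul, smul_sub]
  have h1 : (fun ε : ℝ => -(I : ℂ) • ((mourreG U M ε z - mourreG U M ε₀ z) * M * mourreG U M ε₀ z))
      =o[𝓝[{ε : ℝ | ε * z.im ≤ 0}] ε₀] fun _ => (1 : ℝ) := by
    rw [Asymptotics.isLittleO_one_iff]
    have := (((hcont.sub_const (mourreG U M ε₀ z)).mul_const M).mul_const
      (mourreG U M ε₀ z)).const_smul (-(I : ℂ))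
    simpa using this
  have h2 : (fun ε : ℝ => ((ε - ε₀ : ℝ) : ℂ)) =O[𝓝[{ε : ℝ | ε * z.im ≤ 0}] ε₀] fun ε : ℝ => ε - ε₀ := by
    refine Asymptotics.IsBigO.of_bound 1 (Eventually.of_forall fun ε => ?_)
    rw [Complex.norm_real, one_mul]
  have h3 := h2.smul_isLittleO h1
  simp only [smul_eq_mul, mul_one] at h3
  exact h3.congr' heq EventuallyEq.rfl

/-- **`d/dε G_ε(z) = -i G_ε(z) M G_ε(z)`** in operator norm at every `ε₀` with `ε₀ · Im z < 0`
(two-sided derivative at interior points of the half-line).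
[cite: AmreinBoutetdeMonvelGeorgescu1996, Lemma 7.3.4] -/
theorem hasDerivAt_mourreG {M : H →L[ℂ] H} (hM : ∀ f : H, 0 ≤ (⟪f, M f⟫_ℂ).re) {z : ℂ}
    (hz : z.im ≠ 0) {ε₀ : ℝ} (hε₀ : ε₀ * z.im < 0) (U : OneParameterUnitaryGroup H) :
    HasDerivAt (fun ε : ℝ => mourreG U M ε z)
      (-(I : ℂ) • (mourreG U M ε₀ z * M * mourreG U M ε₀ z)) ε₀ := by
  refine (hasDerivWithinAt_mourreG hM hz hε₀.le U).hasDerivAt ?_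
  have ho : IsOpen {ε : ℝ | ε * z.im < 0} :=
    isOpen_lt (continuous_id.mul continuous_const) continuous_const
  refine mem_of_superset (ho.mem_nhds (by simpa only [Set.mem_setOf_eq] using hε₀)) ?_
  intro ε hε
  simp only [Set.mem_setOf_eq] at hε ⊢
  exact hε.le

/-- For `Im z < 0` the half-line `{ε · Im z ≤ 0}` is `[0, ∞)`. [folklore] -/
theorem setOf_mul_im_nonpos_eq_Ici {z : ℂ} (hz : z.im < 0) : {ε : ℝ | ε * z.im ≤ 0} = Set.Ici 0 := by
  ext ε
  simp only [Set.mem_setOf_eq, Set.mem_Ici]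
  constructor
  · intro h
    by_contra hε
    exact absurd h (not_le.2 (mul_pos_of_neg_of_neg (not_le.1 hε) hz))
  · exact fun h => mul_nonpos_of_nonneg_of_nonpos h hz.le

/-- **The LAP case `Im z < 0`, `ε ≥ 0`**: `ε ↦ G_ε(z)` has derivative `-i G_ε(z) M G_ε(z)` within
`[0, ∞)` at every `ε₀ ≥ 0` (in particular it is norm-continuous on `[0, ∞)` with `G_0 = R(z)`).
[cite: AmreinBoutetdeMonvelGeorgescu1996, Lemma 7.3.4] -/
theorem hasDerivWithinAt_mourreG_Ici {M : H →L[ℂ] H} (hM : ∀ f : H, 0 ≤ (⟪f, M f⟫_ℂ).re) {z : ℂ}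
    (hz : z.im < 0) {ε₀ : ℝ} (hε₀ : 0 ≤ ε₀) (U : OneParameterUnitaryGroup H) :
    HasDerivWithinAt (fun ε : ℝ => mourreG U M ε z)
      (-(I : ℂ) • (mourreG U M ε₀ z * M * mourreG U M ε₀ z)) (Set.Ici 0) ε₀ := by
  rw [← setOf_mul_im_nonpos_eq_Ici hz]
  exact hasDerivWithinAt_mourreG hM hz.ne (mul_nonpos_of_nonneg_of_nonpos hε₀ hz.le) U

/-- Norm-continuity of `ε ↦ G_ε(z)` on `[0, ∞)` for `Im z < 0` (with `G_0 = R(z)`). [folklore] -/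
theorem continuousOn_mourreG_Ici {M : H →L[ℂ] H} (hM : ∀ f : H, 0 ≤ (⟪f, M f⟫_ℂ).re) {z : ℂ}
    (hz : z.im < 0) (U : OneParameterUnitaryGroup H) :
    ContinuousOn (fun ε : ℝ => mourreG U M ε z) (Set.Ici 0) := fun _ hε =>
  (hasDerivWithinAt_mourreG_Ici hM hz hε U).continuousWithinAt

/-- Vector form: `d/dε G_ε(z) g = -i G_ε(z) M G_ε(z) g` at `ε₀ · Im z < 0`.
[cite: AmreinBoutetdeMonvelGeorgescu1996, Lemma 7.3.4] -/
theorem hasDerivAt_mourreG_apply {M : H →L[ℂ] H} (hM : ∀ f : H, 0 ≤ (⟪f, M f⟫_ℂ).re) {z : ℂ}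
    (hz : z.im ≠ 0) {ε₀ : ℝ} (hε₀ : ε₀ * z.im < 0) (U : OneParameterUnitaryGroup H) (g : H) :
    HasDerivAt (fun ε : ℝ => mourreG U M ε z g)
      (-(I : ℂ) • mourreG U M ε₀ z (M (mourreG U M ε₀ z g))) ε₀ :=
  ((ContinuousLinearMap.apply ℂ H g).restrictScalars ℝ).hasFDerivAt.comp_hasDerivAt ε₀
    (hasDerivAt_mourreG hM hz hε₀ U)

/-- Vector form within `[0, ∞)` for `Im z < 0`, `ε₀ ≥ 0`.
[cite: AmreinBoutetdeMonvelGeorgescu1996, Lemma 7.3.4] -/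
theorem hasDerivWithinAt_mourreG_apply_Ici {M : H →L[ℂ] H} (hM : ∀ f : H, 0 ≤ (⟪f, M f⟫_ℂ).re)
    {z : ℂ} (hz : z.im < 0) {ε₀ : ℝ} (hε₀ : 0 ≤ ε₀) (U : OneParameterUnitaryGroup H) (g : H) :
    HasDerivWithinAt (fun ε : ℝ => mourreG U M ε z g)
      (-(I : ℂ) • mourreG U M ε₀ z (M (mourreG U M ε₀ z g))) (Set.Ici 0) ε₀ :=
  ((ContinuousLinearMap.apply ℂ H g).restrictScalars ℝ).hasFDerivAt.comp_hasDerivWithinAt ε₀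
    (hasDerivWithinAt_mourreG_Ici hM hz hε₀ U)

/-- **Scalar form: `d/dε ⟪f, G_ε(z) g⟫ = -i ⟪f, G_ε(z) M G_ε(z) g⟫`** at `ε₀ · Im z < 0` (the
derivative of Mourre's function `F_ε = ⟪f, G_ε(z) f⟫` in the differential inequality).
[cite: AmreinBoutetdeMonvelGeorgescu1996, Lemma 7.3.4] -/
theorem hasDerivAt_inner_mourreG {M : H →L[ℂ] H} (hM : ∀ f : H, 0 ≤ (⟪f, M f⟫_ℂ).re) {z : ℂ}
    (hz : z.im ≠ 0) {ε₀ : ℝ} (hε₀ : ε₀ * z.im < 0) (U : OneParameterUnitaryGroup H) (f g : H) :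
    HasDerivAt (fun ε : ℝ => ⟪f, mourreG U M ε z g⟫_ℂ)
      (-(I : ℂ) * ⟪f, mourreG U M ε₀ z (M (mourreG U M ε₀ z g))⟫_ℂ) ε₀ := by
  simpa [inner_smul_right] using
    (hasDerivAt_const ε₀ f).inner ℂ (hasDerivAt_mourreG_apply hM hz hε₀ U g)

/-- Scalar form within `[0, ∞)` for `Im z < 0`, `ε₀ ≥ 0`.
[cite: AmreinBoutetdeMonvelGeorgescu1996, Lemma 7.3.4] -/
theorem hasDerivWithinAt_inner_mourreG_Ici {M : H →L[ℂ] H} (hM : ∀ f : H, 0 ≤ (⟪f, M f⟫_ℂ).re)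
    {z : ℂ} (hz : z.im < 0) {ε₀ : ℝ} (hε₀ : 0 ≤ ε₀) (U : OneParameterUnitaryGroup H) (f g : H) :
    HasDerivWithinAt (fun ε : ℝ => ⟪f, mourreG U M ε z g⟫_ℂ)
      (-(I : ℂ) * ⟪f, mourreG U M ε₀ z (M (mourreG U M ε₀ z g))⟫_ℂ) (Set.Ici 0) ε₀ := by
  simpa [inner_smul_right] using
    (hasDerivWithinAt_const ε₀ (Set.Ici 0) f).inner ℂ (hasDerivWithinAt_mourreG_apply_Ici hM hz hε₀ U g)

/-! ## §2. Adjoints: `G_ε(z)[M]† = G_{-ε}(z̄)[M†]` -/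

/-- **The adjoint of Mourre's resolvent is the mirrored resolvent**:
`(G_ε(z)[M])† = G_{-ε}(z̄)[M†]` (`G = K̃⁻¹ R(z)`, `R(z)† = R(z̄)`, `K̃_ε(z)[M]† = K_{-ε}(z̄)[M†]`);
the mirrored parameters again satisfy `(-ε) · Im z̄ = ε · Im z ≤ 0` and `M†` is dissipative, so
every estimate of `…LAPDissipativeResolvent{,Identities}` applies to `G†`.
[cite: AmreinBoutetdeMonvelGeorgescu1996, Lemma 7.3.3] -/
theorem adjoint_mourreG {M : H →L[ℂ] H} (hM : ∀ f : H, 0 ≤ (⟪f, M f⟫_ℂ).re) {z : ℂ}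
    (hz : z.im ≠ 0) {ε : ℝ} (hεz : ε * z.im ≤ 0) (U : OneParameterUnitaryGroup H) :
    ContinuousLinearMap.adjoint (mourreG U M ε z) =
      mourreG U (ContinuousLinearMap.adjoint M) (-ε) (conj z) := by
  rw [mourreG_eq_mourreKtinv_mul hM hz hεz U, ← ContinuousLinearMap.star_eq_adjoint, star_mul,
    mourreKtinv, ← Ring.inverse_star, ContinuousLinearMap.star_eq_adjoint,
    ContinuousLinearMap.star_eq_adjoint, adjoint_resolventAt hz U, adjoint_mourreKt U M ε hz]
  rfl

/-- `‖G†‖ = ‖G‖ ≤ 1/|Im z|`. [cite: AmreinBoutetdeMonvelGeorgescu1996, Lemma 7.3.3] -/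
theorem norm_adjoint_mourreG_le {M : H →L[ℂ] H} (hM : ∀ f : H, 0 ≤ (⟪f, M f⟫_ℂ).re) {z : ℂ}
    (hz : z.im ≠ 0) {ε : ℝ} (hεz : ε * z.im ≤ 0) (U : OneParameterUnitaryGroup H) :
    ‖ContinuousLinearMap.adjoint (mourreG U M ε z)‖ ≤ |z.im|⁻¹ := by
  rw [LinearIsometryEquiv.norm_map]
  exact norm_mourreG_le hM hz hεz U

/-- For self-adjoint dissipative `M`: `(G_ε(z))† = G_{-ε}(z̄)` (same `M`).
[cite: AmreinBoutetdeMonvelGeorgescu1996, Lemma 7.3.3] -/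
theorem adjoint_mourreG_of_isSelfAdjoint {M : H →L[ℂ] H} (hM : ∀ f : H, 0 ≤ (⟪f, M f⟫_ℂ).re)
    (hMsa : IsSelfAdjoint M) {z : ℂ} (hz : z.im ≠ 0) {ε : ℝ} (hεz : ε * z.im ≤ 0)
    (U : OneParameterUnitaryGroup H) :
    ContinuousLinearMap.adjoint (mourreG U M ε z) = mourreG U M (-ε) (conj z) := by
  rw [adjoint_mourreG hM hz hεz U, ContinuousLinearMap.isSelfAdjoint_iff'.1 hMsa]

/-- **`G† h ∈ D(H)` with `H (G† h) = h + iε M (G† h) + z̄ G† h`** for self-adjoint dissipative `M`,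
i.e. `(H - z̄ - iεM) G† = 1`. [cite: AmreinBoutetdeMonvelGeorgescu1996, Lemma 7.3.3] -/
theorem adjoint_mourreG_mem_hamiltonian_domain {M : H →L[ℂ] H}
    (hM : ∀ f : H, 0 ≤ (⟪f, M f⟫_ℂ).re) (hMsa : IsSelfAdjoint M) {z : ℂ} (hz : z.im ≠ 0) {ε : ℝ}
    (hεz : ε * z.im ≤ 0) (U : OneParameterUnitaryGroup H) (h : H) :
    ∃ hd : ContinuousLinearMap.adjoint (mourreG U M ε z) h ∈ U.hamiltonian.domain,
      U.hamiltonian ⟨ContinuousLinearMap.adjoint (mourreG U M ε z) h, hd⟩ =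
        h + ((I : ℂ) * ε) • M (ContinuousLinearMap.adjoint (mourreG U M ε z) h) +
          conj z • ContinuousLinearMap.adjoint (mourreG U M ε z) h := by
  have hz' : (conj z).im ≠ 0 := by rw [Complex.conj_im]; exact neg_ne_zero.2 hz
  have hεz' : -ε * (conj z).im ≤ 0 := by rw [neg_mul_conj_im]; exact hεz
  rw [adjoint_mourreG_of_isSelfAdjoint hM hMsa hz hεz U]
  obtain ⟨hd, hH⟩ := mourreG_mem_hamiltonian_domain hM hz' hεz' U h
  refine ⟨hd, ?_⟩
  rw [hH, Complex.ofReal_neg, mul_neg, neg_smul, sub_neg_eq_add]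

/-! ## §3. Headline (registered helper stub) -/

/-- **`d/dε G_ε(z) = -i G_ε(z) M G_ε(z)` in operator norm, headline form** (all binders explicit;
registered helper stub of `stub_mourreThresholdLAP`): for dissipative `M`, non-real `z` and
`ε₀ · Im z < 0`, the map `ε ↦ G_ε(z)` is differentiable at `ε₀` with derivative
`-i G_{ε₀}(z) M G_{ε₀}(z)`. [cite: AmreinBoutetdeMonvelGeorgescu1996, Lemma 7.3.4] -/
theorem hasDerivAt_mourreG_dissipative :
    ∀ (K : Type) [NormedAddCommGroup K] [InnerProductSpace ℂ K] [CompleteSpace K]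
      (U : Literature.Analysis.UnboundedOperators.OneParameterUnitaryGroup K) (M : K →L[ℂ] K)
      (ε₀ : ℝ) (z : ℂ), (∀ f : K, 0 ≤ (inner ℂ f (M f)).re) → z.im ≠ 0 → ε₀ * z.im < 0 →
        HasDerivAt
          (fun ε : ℝ => Summit.AtomisticToContinuum.FouriersLaw.Theorems.MourreDissolution.mourreG U M ε z)
          (-Complex.I •
            (Summit.AtomisticToContinuum.FouriersLaw.Theorems.MourreDissolution.mourreG U M ε₀ z * M *
              Summit.AtomisticToContinuum.FouriersLaw.Theorems.MourreDissolution.mourreG U M ε₀ z)) ε₀ := by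
  intro K _ _ _ U M ε₀ z hM hz hε₀
  exact hasDerivAt_mourreG hM hz hε₀ U

end Summit.AtomisticToContinuum.FouriersLaw.Theorems.MourreDissolution
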